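import Summits.NavierStokesRegularity.NavierStokesRegularity.Theorems.TypeICertificateLadderTargetGaussianDissipation
import Summits.NavierStokesRegularity.NavierStokesRegularity.Theorems.TypeICertificateLadderTargetHeadFluxCriterion
import HarnessLib

/-!
# Crux `NoTypeIBlowup` (stmt-NavierStokesRegularity-1217), line `head-flux-channel`:
  helper 2 of STUB S2c (`stub_gaussianEnergyDeriv`) — rate-class bounds in similarity variables

-- adapted from Cruxes/Target/S2cProof.lean (refuter-drefute), Part 2; copied, not imported; the
-- Hessian, Laplacian, time-derivative and pressure-gradient bounds are re-derived directly in
-- similarity variables from the KNSS window bounds and the Navier–Stokes zoom (Theses-free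
-- import closure, as for S2a).

For a Type-I ancient mild field `u` (`IsTypeIAncientMild C u`: jointly smooth on `t < 0`,
divergence free, KNSS-mild, `|u| ≤ C/√(−t)`) and its Leray orbit
`U(s, y) = e^{−s/2} u(−e^{−s}, e^{−s/2} y)` (`lerayOrbit u`):

* `|U| ≤ C` (the tree's `headFlux_norm_lerayOrbit_le`);
* `exists_norm_iteratedFDeriv_two_lerayOrbit_le` — `|D²U(s)(y)| ≤ B₂(C)` for ALL `s, y`: KNSS 2009
  (4.10) with `k = 2` on the window `[−2, −1/2)` (tree `exists_norm_iteratedFDeriv_le_of_typeI`)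
  for the zoomed class member `c • stPull (c²) c 0 0 u`, `c = e^{−s/2}` (`isTypeIAncientMild_zoom`),
  whose slice at `−1` IS `U(s)` (`HeadFluxChannelS2a.zoom_slice_neg_one_eq_lerayOrbit`); hence
  `exists_norm_laplacian_lerayOrbit_le`, `|ΔU| ≤ 3B₂`;
* `exists_norm_lerayOrbitForce_timeDeriv_le` — `|e^{−3s/2} ∂ₜu(−e^{−s}, e^{−s/2}y)| ≤ L(C)`: KNSS
  2009 (4.11) with `k = 0` (tree `exists_lipschitz_time_of_typeI`) makes the time line of the same
  zoom through `(−1, y)` `L`-Lipschitz, so its derivative `c³ ∂ₜu(−c², c y)` (`timeDeriv_stPull`)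
  has norm `≤ L` (`norm_deriv_le_of_lip'`);
* `lerayOrbitPressure_bounds` — for ANY classical pressure `p` of `u` on `(−∞, 0)` the similarity
  pressure `P = lerayOrbitPressure p` has `|∇P| ≤ C₃` and `|P(s, y)| ≤ |P(s, 0)| + C₃|y|`: by Leray's
  momentum equation in similarity variables (`isClassicalNSSolutionOn_Iio_iff_isBackwardLeraySolutionOn`,
  `IsBackwardLeraySolutionOn.momentum_leray`) and `∂ₛU + ½U + ½(y·∇)U = e^{−3s/2}∂ₜu`
  (`lerayOrbitForce_timeDeriv`), `∇P = ΔU − e^{−3s/2}∂ₜu − (U·∇)U`, each term bounded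
  (`|∇U| ≤ K₀(C)`, `HeadFluxChannelS2a.exists_norm_fderiv_lerayOrbit_le`); then the mean value theorem;
* `exists_norm_deriv_lerayOrbit_le` — LINEAR GROWTH of `∂ₛU`: `|∂ₛU(s, y)| ≤ K(1 + |y|)`
  (`∂ₛU = e^{−3s/2}∂ₜu − ½U − ½(DU)y`); its closed form `gaussianEnergy_derivGrowth` is the
  registered sub-goal of the crux item.

Lands `--supports stmt-NavierStokesRegularity-1217`.
-/

noncomputable section

namespace Summit.NavierStokesRegularity.NavierStokesRegularity.Theorems.HeadFluxChannelS2c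

open MeasureTheory Set Filter Topology Function InnerProductSpace
open scoped RealInnerProductSpace Laplacian ContDiff
open Literature.Analysis Literature.Analysis.FluidPDE
open Summit.NavierStokesRegularity.NavierStokesRegularity.Theorems

variable {C : ℝ} {u : ℝ → EuclideanSpace ℝ (Fin 3) → EuclideanSpace ℝ (Fin 3)}
  {p : ℝ → EuclideanSpace ℝ (Fin 3) → ℝ}

/-- **Class-uniform global Hessian bound in similarity variables**: there is `B₂ = B₂(C)` with
`‖D²U(s)(y)‖ ≤ B₂` for ALL `s, y` and every class member (KNSS 2009 (4.10), `k = 2`, at time `−1`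
for the zoomed class member whose `−1`-slice is `U(s)`). [cite: KochNadirashviliSereginSverak2009, Prop. 4.1 (4.6)/(4.10) with k = 2 and §1 (1.2) (arXiv:0709.3599v1 pp. 2, 8)] -/
theorem exists_norm_iteratedFDeriv_two_lerayOrbit_le (C : ℝ) :
    ∃ B₂ : ℝ, ∀ ⦃u : ℝ → EuclideanSpace ℝ (Fin 3) → EuclideanSpace ℝ (Fin 3)⦄,
      IsTypeIAncientMild C u → ∀ s y, ‖iteratedFDeriv ℝ 2 (lerayOrbit u s) y‖ ≤ B₂ := by
  obtain ⟨K, hK⟩ := exists_norm_iteratedFDeriv_le_of_typeI C 2 (a := -3) (b := -(1 / 2))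
    (δ := 1) (by norm_num) (by norm_num) one_pos
  refine ⟨K, fun u hu s y => ?_⟩
  set c : ℝ := Real.exp (-s / 2) with hcdef
  have hc : 0 < c := Real.exp_pos _
  have hw : IsTypeIAncientMild C (c • stPull (c ^ 2) c 0 0 u) := isTypeIAncientMild_zoom hu hc 0
  have h := hK hw.continuousOn_uncurry (fun t ht => hw.isWeaklyDivFree ht)
    (fun t r htr hr x => hw.mild_eq_heatExtension htr hr x) hw.hasTypeITimeDecay (-1)
    ⟨by norm_num, by norm_num⟩ y
  rwa [hcdef, HeadFluxChannelS2a.zoom_slice_neg_one_eq_lerayOrbit] at h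

/-- **Class-uniform global Laplacian bound in similarity variables**: `‖ΔU(s)(y)‖ ≤ 3 B₂(C)`
(`‖Δf‖ ≤ dim · ‖D²f‖`). [folklore] -/
theorem exists_norm_laplacian_lerayOrbit_le (C : ℝ) :
    ∃ K₂ : ℝ, ∀ ⦃u : ℝ → EuclideanSpace ℝ (Fin 3) → EuclideanSpace ℝ (Fin 3)⦄,
      IsTypeIAncientMild C u → ∀ s y, ‖(Δ (lerayOrbit u s)) y‖ ≤ K₂ := by
  obtain ⟨B₂, hB₂⟩ := exists_norm_iteratedFDeriv_two_lerayOrbit_le C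
  refine ⟨3 * B₂, fun u hu s y => ?_⟩
  have e : ‖fderiv ℝ (fderiv ℝ (lerayOrbit u s)) y‖ ≤ B₂ := by
    rw [← norm_iteratedFDeriv_one (𝕜 := ℝ) (fderiv ℝ (lerayOrbit u s)),
      norm_iteratedFDeriv_fderiv]
    exact hB₂ hu s y
  calc ‖(Δ (lerayOrbit u s)) y‖
      ≤ Module.finrank ℝ (EuclideanSpace ℝ (Fin 3)) * ‖fderiv ℝ (fderiv ℝ (lerayOrbit u s)) y‖ :=
        norm_laplacian_le _ y
    _ = 3 * ‖fderiv ℝ (fderiv ℝ (lerayOrbit u s)) y‖ := by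
        rw [finrank_euclideanSpace_fin]; norm_num
    _ ≤ 3 * B₂ := mul_le_mul_of_nonneg_left e (by norm_num)

/-- **Class-uniform bound on the transformed time derivative**: there is `L = L(C) ≥ 0` with
`‖lerayOrbitForce (∂ₜu) s y‖ = ‖e^{−3s/2} ∂ₜu(−e^{−s}, e^{−s/2} y)‖ ≤ L` for all `s, y` and every
class member (KNSS 2009 (4.11), `k = 0`: the time line through `(−1, y)` of the zoomed class member
`w = c • stPull (c²) c 0 0 u`, `c = e^{−s/2}`, is `L`-Lipschitz on `[−2, −1/2)`, and
`∂ₛw(−1, y) = c³ ∂ₜu(−c², c y)`). [cite: KochNadirashviliSereginSverak2009, Prop. 4.1 (4.11) with k = 0 and §1 (1.2) (arXiv:0709.3599v1 pp. 2, 8)] -/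
theorem exists_norm_lerayOrbitForce_timeDeriv_le (C : ℝ) :
    ∃ L : ℝ, 0 ≤ L ∧ ∀ ⦃u : ℝ → EuclideanSpace ℝ (Fin 3) → EuclideanSpace ℝ (Fin 3)⦄,
      IsTypeIAncientMild C u → ∀ s y, ‖lerayOrbitForce (timeDeriv u) s y‖ ≤ L := by
  obtain ⟨L, hL0, hL⟩ := exists_lipschitz_time_of_typeI C 0 (a := -3) (b := -(1 / 2)) (δ := 1)
    (by norm_num) (by norm_num) one_pos
  refine ⟨L, hL0, fun u hu s y => ?_⟩
  have hc : 0 < Real.exp (-s / 2) := Real.exp_pos _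
  set w : ℝ → EuclideanSpace ℝ (Fin 3) → EuclideanSpace ℝ (Fin 3) :=
    Real.exp (-s / 2) • stPull (Real.exp (-s / 2) ^ 2) (Real.exp (-s / 2)) 0 0 u with hwdef
  have hw : IsTypeIAncientMild C w := isTypeIAncientMild_zoom hu hc 0
  -- the time line of `w` through `(-1, y)` is `L`-Lipschitz on `[-2, -1/2)`
  have hlip : ∀ r ∈ Ico (-2 : ℝ) (-(1 / 2)), ‖w r y - w (-1) y‖ ≤ L * ‖r - (-1)‖ := by
    intro r hr
    have h := hL hw.continuousOn_uncurry (fun t ht => hw.isWeaklyDivFree ht)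
      (fun t t' htt' ht' x => hw.mild_eq_heatExtension htt' ht' x) hw.hasTypeITimeDecay (-1)
      ⟨by norm_num, by norm_num⟩ r ⟨by linarith [hr.1], by linarith [hr.2]⟩ y
    have e : ‖iteratedFDeriv ℝ 0 (w r) y - iteratedFDeriv ℝ 0 (w (-1)) y‖ =
        ‖w r y - w (-1) y‖ := by
      rw [iteratedFDeriv_zero_eq_comp, iteratedFDeriv_zero_eq_comp, Function.comp_apply,
        Function.comp_apply, ← map_sub, LinearIsometryEquiv.norm_map]
    rw [e, ← Real.norm_eq_abs] at h
    exact h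
  have hder : ‖deriv (fun r => w r y) (-1)‖ ≤ L := by
    refine norm_deriv_le_of_lip' hL0 ?_
    filter_upwards [Ico_mem_nhds (show (-2 : ℝ) < -1 by norm_num)
      (show (-1 : ℝ) < -(1 / 2) by norm_num)] with r hr
    exact hlip r hr
  -- `∂ₛ w(-1, y) = c³ ∂ₜu(-c², c y) = lerayOrbitForce (∂ₜu) s y`
  have ht : -Real.exp (-s) < 0 := neg_neg_of_pos (Real.exp_pos _)
  have ht1 : (0 : ℝ) + Real.exp (-s / 2) ^ 2 * (-1) = -Real.exp (-s) := by
    rw [exp_neg_half_sq]; ring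
  have huS : IsSmoothSpaceTimeOn (Iio 0) u := hu.contDiffOn
  have hdiffu : DifferentiableAt ℝ
      (fun r => u r ((0 : EuclideanSpace ℝ (Fin 3)) + Real.exp (-s / 2) • y))
      (0 + Real.exp (-s / 2) ^ 2 * (-1)) := by
    rw [ht1]
    exact (huS.differentiableWithinAt_time ht _).differentiableAt (Iio_mem_nhds ht)
  have hdiffst : DifferentiableAt ℝ
      (fun r => stPull (Real.exp (-s / 2) ^ 2) (Real.exp (-s / 2)) 0 0 u r y) (-1) := by
    have e : (fun r => stPull (Real.exp (-s / 2) ^ 2) (Real.exp (-s / 2)) 0 0 u r y) =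
        (fun r => u r ((0 : EuclideanSpace ℝ (Fin 3)) + Real.exp (-s / 2) • y)) ∘
          fun r : ℝ => 0 + Real.exp (-s / 2) ^ 2 * r := rfl
    rw [e]
    exact hdiffu.comp (-1) ((differentiableAt_const _).add
      ((differentiableAt_const _).mul differentiableAt_id))
  have key : deriv (fun r => w r y) (-1) = lerayOrbitForce (timeDeriv u) s y := by
    have e : (fun r => w r y) =
        fun r =>
          Real.exp (-s / 2) • stPull (Real.exp (-s / 2) ^ 2) (Real.exp (-s / 2)) 0 0 u r y :=
      rfl
    rw [e, deriv_fun_const_smul _ hdiffst,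
      ← timeDeriv_apply (stPull (Real.exp (-s / 2) ^ 2) (Real.exp (-s / 2)) 0 0 u) (-1) y,
      timeDeriv_stPull, ht1, zero_add, smul_smul, lerayOrbitForce_apply]
    congr 1
    ring
  rw [key] at hder
  exact hder

/-- **Bounds for ANY classical pressure of a class member, in similarity variables**: for
`P = lerayOrbitPressure p`, `‖∇P(s)(y)‖ ≤ C₃` and `|P(s, y)| ≤ |P(s, 0)| + C₃‖y‖` for all `s, y`
(`∇P = ΔU − e^{−3s/2}∂ₜu − (U·∇)U` by Leray's momentum equation and `lerayOrbitForce_timeDeriv`;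
the three class-uniform bounds; the mean value theorem). [folklore] -/
theorem lerayOrbitPressure_bounds (hu : IsTypeIAncientMild C u)
    (hp : IsClassicalNSSolutionOn (Iio 0) 1 0 u p) :
    ∃ C₃ : ℝ, 0 ≤ C₃ ∧ (∀ s y, ‖gradient (lerayOrbitPressure p s) y‖ ≤ C₃) ∧
      ∀ s y, |lerayOrbitPressure p s y| ≤ |lerayOrbitPressure p s 0| + C₃ * ‖y‖ := by
  obtain ⟨K₀, hK₀⟩ := HeadFluxChannelS2a.exists_norm_fderiv_lerayOrbit_le C
  obtain ⟨K₂, hK₂⟩ := exists_norm_laplacian_lerayOrbit_le C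
  obtain ⟨L, hL0, hL⟩ := exists_norm_lerayOrbitForce_timeDeriv_le C
  have hBL := isClassicalNSSolutionOn_Iio_iff_isBackwardLeraySolutionOn.1 hp
  have hP : IsSmoothSpaceTimeOn univ (lerayOrbitPressure p) := hBL.smooth_pressure
  have hC0 : 0 ≤ C := hu.nonneg
  have hK₀0 : 0 ≤ K₀ := (norm_nonneg _).trans (hK₀ hu 0 0)
  have hK₂0 : 0 ≤ K₂ := (norm_nonneg _).trans (hK₂ hu 0 0)
  have hgrad : ∀ s y, ‖gradient (lerayOrbitPressure p s) y‖ ≤ K₂ + L + K₀ * C := by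
    intro s y
    -- Leray's momentum equation at `(s, y)` and the transformed time derivative
    have hm := hBL.momentum_leray (mem_univ s) y
    rw [timeDerivWithin_apply, derivWithin_univ, one_smul] at hm
    have ht : -Real.exp (-s) < 0 := neg_neg_of_pos (Real.exp_pos _)
    have hd : DifferentiableAt ℝ (uncurry u) (ancientSimMap (s, y)) := by
      have hmem : ancientSimMap (s, y) ∈ Iio (0 : ℝ) ×ˢ (univ : Set (EuclideanSpace ℝ (Fin 3))) :=
        ⟨ht, mem_univ _⟩
      exact (hu.contDiffOn.contDiffAt ((isOpen_Iio.prod isOpen_univ).mem_nhds hmem)).differentiableAt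
        (by simp)
    have key := lerayOrbitForce_timeDeriv hd
    rw [timeDeriv_apply] at key
    have e : gradient (lerayOrbitPressure p s) y = (Δ (lerayOrbit u s)) y -
        lerayOrbitForce (timeDeriv u) s y - convect (lerayOrbit u s) (lerayOrbit u s) y := by
      rw [← key, ← hm]; abel
    have h3 : ‖convect (lerayOrbit u s) (lerayOrbit u s) y‖ ≤ K₀ * C := by
      rw [convect_apply]
      exact (ContinuousLinearMap.le_opNorm _ _).trans
        (mul_le_mul (hK₀ hu s y) (headFlux_norm_lerayOrbit_le hu s y) (norm_nonneg _) hK₀0)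
    rw [e]
    exact (norm_sub_le _ _).trans (add_le_add ((norm_sub_le _ _).trans
      (add_le_add (hK₂ hu s y) (hL hu s y))) h3)
  refine ⟨K₂ + L + K₀ * C, by positivity, hgrad, fun s y => ?_⟩
  have hd : ∀ z ∈ (univ : Set (EuclideanSpace ℝ (Fin 3))),
      DifferentiableAt ℝ (lerayOrbitPressure p s) z := fun z _ =>
    ((hP.contDiff_slice (mem_univ s)).differentiable (by simp)).differentiableAt
  have hb : ∀ z ∈ (univ : Set (EuclideanSpace ℝ (Fin 3))),
      ‖fderiv ℝ (lerayOrbitPressure p s) z‖ ≤ K₂ + L + K₀ * C := by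
    intro z _
    have e : ‖gradient (lerayOrbitPressure p s) z‖ =
        ‖fderiv ℝ (lerayOrbitPressure p s) z‖ := by
      rw [gradient, LinearIsometryEquiv.norm_map]
    rw [← e]; exact hgrad s z
  have hmv := Convex.norm_image_sub_le_of_norm_fderiv_le hd hb convex_univ (mem_univ 0) (mem_univ y)
  rw [sub_zero, Real.norm_eq_abs] at hmv
  have htri : |lerayOrbitPressure p s y| ≤
      |lerayOrbitPressure p s 0| + |lerayOrbitPressure p s y - lerayOrbitPressure p s 0| := by
    have := abs_add_le (lerayOrbitPressure p s 0)
      (lerayOrbitPressure p s y - lerayOrbitPressure p s 0)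
    rwa [add_sub_cancel] at this
  linarith

/-- **Linear growth of `∂ₛU` in similarity variables**: `‖∂ₛU(s, y)‖ ≤ (L + C/2 + K₀/2)(1 + ‖y‖)`
for all `s, y` (`∂ₛU = e^{−3s/2}∂ₜu − ½U − ½(DU)y`, `lerayOrbitForce_timeDeriv`, with the
class-uniform bounds `‖e^{−3s/2}∂ₜu‖ ≤ L`, `‖U‖ ≤ C`, `‖DU‖ ≤ K₀`). [folklore] -/
theorem exists_norm_deriv_lerayOrbit_le (hu : IsTypeIAncientMild C u) :
    ∃ K : ℝ, ∀ s y, ‖deriv (fun σ => lerayOrbit u σ y) s‖ ≤ K * (1 + ‖y‖) := by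
  obtain ⟨L, hL0, hL⟩ := exists_norm_lerayOrbitForce_timeDeriv_le C
  obtain ⟨K₀, hK₀⟩ := HeadFluxChannelS2a.exists_norm_fderiv_lerayOrbit_le C
  have hK₀0 : 0 ≤ K₀ := (norm_nonneg _).trans (hK₀ hu 0 0)
  have hC0 : 0 ≤ C := hu.nonneg
  refine ⟨L + C / 2 + K₀ / 2, fun s y => ?_⟩
  have ht : -Real.exp (-s) < 0 := neg_neg_of_pos (Real.exp_pos _)
  have hd : DifferentiableAt ℝ (uncurry u) (ancientSimMap (s, y)) := by
    have hmem : ancientSimMap (s, y) ∈ Iio (0 : ℝ) ×ˢ (univ : Set (EuclideanSpace ℝ (Fin 3))) :=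
      ⟨ht, mem_univ _⟩
    exact (hu.contDiffOn.contDiffAt ((isOpen_Iio.prod isOpen_univ).mem_nhds hmem)).differentiableAt
      (by simp)
  have key := lerayOrbitForce_timeDeriv hd
  rw [timeDeriv_apply] at key
  have e : deriv (fun σ => lerayOrbit u σ y) s = lerayOrbitForce (timeDeriv u) s y -
      (1 / 2 : ℝ) • lerayOrbit u s y - (1 / 2 : ℝ) • fderiv ℝ (lerayOrbit u s) y y := by
    rw [← key]; abel
  have h1 : ‖lerayOrbitForce (timeDeriv u) s y‖ ≤ L := hL hu s y
  have h2 : ‖(1 / 2 : ℝ) • lerayOrbit u s y‖ ≤ C / 2 := by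
    rw [norm_smul, Real.norm_of_nonneg (by norm_num)]
    have := headFlux_norm_lerayOrbit_le hu s y
    linarith
  have h3 : ‖(1 / 2 : ℝ) • fderiv ℝ (lerayOrbit u s) y y‖ ≤ K₀ / 2 * ‖y‖ := by
    rw [norm_smul, Real.norm_of_nonneg (by norm_num)]
    have := (ContinuousLinearMap.le_opNorm (fderiv ℝ (lerayOrbit u s) y) y).trans
      (mul_le_mul_of_nonneg_right (hK₀ hu s y) (norm_nonneg _))
    linarith
  rw [e]
  refine ((norm_sub_le _ _).trans (add_le_add (norm_sub_le _ _) le_rfl)).trans ?_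
  have hy0 := norm_nonneg y
  nlinarith [h1, h2, h3, mul_nonneg hL0 hy0, mul_nonneg hC0 hy0, mul_nonneg hK₀0 hy0]

end Summit.NavierStokesRegularity.NavierStokesRegularity.Theorems.HeadFluxChannelS2c

/-! ## Registered sub-goal (closed form of the linear growth of `∂ₛU`) -/

namespace Summit.NavierStokesRegularity.NavierStokesRegularity.Theorems

/-- **Registered sub-goal `gaussianEnergy_derivGrowth`** of STUB S2c: along the Leray orbit
`U = lerayOrbit u` of a Type-I ancient mild field, `‖∂ₛU(s, y)‖ ≤ K(1 + ‖y‖)` for some `K` and all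
`s, y` (`HeadFluxChannelS2c.exists_norm_deriv_lerayOrbit_le`) — the domination that lets the Gaussian
energy be differentiated under the integral sign. [folklore] -/
theorem gaussianEnergy_derivGrowth :
    ∀ (C : ℝ) (u : ℝ → EuclideanSpace ℝ (Fin 3) → EuclideanSpace ℝ (Fin 3)),
      Literature.Analysis.FluidPDE.IsTypeIAncientMild C u →
      ∃ K : ℝ, ∀ (s : ℝ) (y : EuclideanSpace ℝ (Fin 3)),
        ‖deriv (fun σ => Literature.Analysis.FluidPDE.lerayOrbit u σ y) s‖ ≤ K * (1 + ‖y‖) :=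
  fun _ _ hu => HeadFluxChannelS2c.exists_norm_deriv_lerayOrbit_le hu

end Summit.NavierStokesRegularity.NavierStokesRegularity.Theorems

end
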